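import Summits.Ventures.HSemireg.WedgeHankelRecurrenceGaussClenshaw

/-!
# Venture HSemireg — **CHEBYSHEV'S ALGORITHM: THE RECURRENCE COEFFICIENTS FROM THE MIXED MOMENTS `σ_{k,p} = Σ_l ν_l q_k(w_l) w_l^p`**: the mixed moments obey the recurrence
# `σ_{k+2,p} = σ_{k+1,p+1} − a_{k+1} σ_{k+1,p} − b_{k+1} σ_{k,p}` (started from the ordinary moments `σ_{0,p} = m_p`), vanish for `p < k`, and satisfy `σ_{k,k} = h_k`,
# `σ_{k,k+1} = h_k (a_0 + ⋯ + a_k)`; hence `a_k = σ_{k,k+1}∕σ_{k,k} − σ_{k−1,k}∕σ_{k−1,k−1}` and `b_k = σ_{k,k}∕σ_{k−1,k−1}`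

HONEST FRAMING. Part of the Lean index of the computation cell `pub-hsemireg` (seat p10 gen 44, Sunday typer «UNIFORM-IN-n»).  Finite sums and real polynomials only; no variety, no cohomology
theory, no sheaf, no Ext group and no semiregularity map is constructed here; nothing here says that HC / HC_CM / HC_AV holds; no Literature fact (unproved `Prop`) is declared or used.  Custodian
versions as in `WedgeHankelSiegelIdeal` (1/3).
SOURCES (cited).  P. L. Chebyshev, *Sur l'interpolation par la méthode des moindres carrés*, Mém. Acad. Impér. Sci. St. Pétersbourg (7) 1 (1859) 1–24; W. Gautschi, *Orthogonal Polynomials: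
Computation and Approximation* (2004) §2.1.7, Algorithm 2.3 (Chebyshev algorithm: `α_k = σ_{k,k+1}∕σ_{kk} − σ_{k−1,k}∕σ_{k−1,k−1}`, `β_k = σ_{kk}∕σ_{k−1,k−1}`, the recursion for `σ_{k,l}`);
J. C. Wheeler, *Modified moments and Gaussian quadratures*, Rocky Mountain J. Math. 4 (1974) 287–296; R. A. Sack, A. F. Donovan, Numer. Math. 18 (1972) 465–478.
PROOF TYPED HERE.  The recursion is the three-term recurrence multiplied by `w^p` and summed; `σ_{k,p} = 0` (`p < k`) is orthogonality; `σ_{kk} = h_k` because `X^k − q_k` has degree `< k`;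
`σ_{k,k+1} = Σ ν q_k (X^{k+1} − q_{k+1}) = coeff_k(X^{k+1} − q_{k+1})·h_k = (a_0 + ⋯ + a_k) h_k` by N298 `coeff_recurrence_sub_one`; then `b_{k+1} = h_{k+1}∕h_k` (N303) and the difference of
consecutive quotients gives `a_{k+1}`.
DEDUP DISCLOSURE (`rg -n -i 'mixed moment|chebyshev algorithm|sigma_' Summits/Ventures/HSemireg Literature`, 2026-09-03): N303 has `a_n h_n = Σ ν w q_n²` and `b_{n+1} = h_{n+1}∕h_n`; the
mixed-moment formulation (moments → coefficients without forming inner products of `q_k²`) is new.  The 7 names below: 0 hits tree-wide.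

WHAT IS IN THE TREE.  N298 `coeff_recurrence_sub_one`; N303 `b_eq_norm_div_norm`; N279 `recurrence_monic_natDegree`; N273 `natDegree_sub_lt_of_monic_of_natDegree_eq`, `sum_mul_eval_sq_pos_of_natDegree_lt`;
N269 `natDegree_sub_C_mul_le_of_monic`.
THIS FILE (namespace `Summit.Ventures.HSemireg.Wedge.HankelOuter` continued; CHAINED on N327 (import only); 0 definitions):
* §1093 **`mixedMoment_recurrence`** (`σ_{k+2,p} = σ_{k+1,p+1} − a_{k+1}σ_{k+1,p} − b_{k+1}σ_{k,p}`), `mixedMoment_one` (`σ_{1,p} = σ_{0,p+1} − a_0 σ_{0,p}`), `mixedMoment_eq_zero_of_lt` (`p < k`),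
  `sum_mul_eval_mul_eq_coeff_mul_norm` (`deg R ≤ k ⇒ Σ ν q_k R = coeff_k(R)·h_k`), **`mixedMoment_diag`** (`σ_{kk} = h_k`), **`mixedMoment_superdiag`** (`σ_{k,k+1} = h_k Σ_{i≤k} a_i`),
  **`recurrence_coeffs_of_mixedMoments`** (`a_0 = σ_{01}∕σ_{00} = Σνw∕Σν`, `a_{k+1} = σ_{k+1,k+2}∕σ_{k+1,k+1} − σ_{k,k+1}∕σ_{kk}`, `b_{k+1} = σ_{k+1,k+1}∕σ_{kk}`).
CAVEATS.  Discrete positive measures (the quotients need `h_k > 0`, i.e. `k < N`).  Nothing Ext-side.  New names only.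
-/

open Module Polynomial
open scoped Matrix Polynomial

namespace Summit.Ventures.HSemireg.Wedge.HankelOuter

/-! ## §1093. Chebyshev's algorithm (mixed moments) -/

/-- **THE MIXED-MOMENT RECURSION `σ_{k+2,p} = σ_{k+1,p+1} − a_{k+1} σ_{k+1,p} − b_{k+1} σ_{k,p}`** (any weights). [Gautschi 2004 Alg. 2.3; this file, §1093] -/
theorem mixedMoment_recurrence {N : ℕ} (ν w : Fin N → ℝ) {q : ℕ → ℝ[X]} {a b : ℕ → ℝ}
    (hrec : ∀ n, q (n + 2) = (Polynomial.X - C (a (n + 1))) * q (n + 1) - C (b (n + 1)) * q n) (k p : ℕ) :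
    ∑ l, ν l * ((q (k + 2)).eval (w l) * w l ^ p) =
      ∑ l, ν l * ((q (k + 1)).eval (w l) * w l ^ (p + 1)) - a (k + 1) * ∑ l, ν l * ((q (k + 1)).eval (w l) * w l ^ p) - b (k + 1) * ∑ l, ν l * ((q k).eval (w l) * w l ^ p) := by
  rw [Finset.mul_sum, Finset.mul_sum, ← Finset.sum_sub_distrib, ← Finset.sum_sub_distrib]
  refine Finset.sum_congr rfl fun l _ => ?_
  rw [hrec k, eval_sub, eval_mul, eval_sub, eval_X, eval_C, eval_mul, eval_C, pow_succ]
  ring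

/-- **`σ_{1,p} = σ_{0,p+1} − a_0 σ_{0,p}`** (the first step, `q_0 = 1`, `q_1 = X − a_0`). [this file, §1093] -/
theorem mixedMoment_one {N : ℕ} (ν w : Fin N → ℝ) {q : ℕ → ℝ[X]} {a : ℕ → ℝ} (hq0 : q 0 = 1) (hq1 : q 1 = Polynomial.X - C (a 0)) (p : ℕ) :
    ∑ l, ν l * ((q 1).eval (w l) * w l ^ p) = ∑ l, ν l * ((q 0).eval (w l) * w l ^ (p + 1)) - a 0 * ∑ l, ν l * ((q 0).eval (w l) * w l ^ p) := by
  rw [Finset.mul_sum, ← Finset.sum_sub_distrib]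
  refine Finset.sum_congr rfl fun l _ => ?_
  rw [hq1, hq0, eval_sub, eval_X, eval_C, eval_one, pow_succ]
  ring

/-- **`σ_{k,p} = 0` for `p < k`** (orthogonality of `q_k` to `X^p`). [this file, §1093] -/
theorem mixedMoment_eq_zero_of_lt {N : ℕ} {ν w : Fin N → ℝ} {q : ℕ → ℝ[X]} {k p : ℕ}
    (horth : ∀ G : ℝ[X], G.natDegree < k → ∑ l, ν l * (q k * G).eval (w l) = 0) (hp : p < k) :
    ∑ l, ν l * ((q k).eval (w l) * w l ^ p) = 0 := by
  have h := horth (Polynomial.X ^ p) (by rw [natDegree_X_pow]; exact hp)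
  simp only [eval_mul, eval_pow, eval_X] at h
  exact h

/-- **`Σ_l ν_l q_k(w_l) R(w_l) = coeff_k(R)·h_k` for `deg R ≤ k`** (`q_k` monic of degree `k`, orthogonal to lower degrees). [this file, §1093] -/
theorem sum_mul_eval_mul_eq_coeff_mul_norm {N : ℕ} {ν w : Fin N → ℝ} {q : ℕ → ℝ[X]} {k : ℕ} (hmonic : (q k).Monic) (hdeg : (q k).natDegree = k)
    (horth : ∀ G : ℝ[X], G.natDegree < k → ∑ l, ν l * (q k * G).eval (w l) = 0) {R : ℝ[X]} (hR : R.natDegree ≤ k) :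
    ∑ l, ν l * ((q k).eval (w l) * R.eval (w l)) = R.coeff k * ∑ l, ν l * ((q k).eval (w l)) ^ 2 := by
  rcases Nat.eq_zero_or_pos k with hk | hk
  · subst hk
    have hR0 : R = C (R.coeff 0) := eq_C_of_natDegree_le_zero hR
    have hq : q 0 = 1 := Polynomial.eq_one_of_monic_natDegree_zero hmonic hdeg
    rw [Finset.mul_sum]
    refine Finset.sum_congr rfl fun l _ => ?_
    rw [hq, eval_one, hR0, eval_C, coeff_C_zero]; ring
  · have hlow : (R - C (R.coeff k) * q k).natDegree < k := by
      have h := natDegree_sub_C_mul_le_of_monic hR hmonic hdeg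
      omega
    have h := horth _ hlow
    have hl : ∀ l, ν l * (q k * (R - C (R.coeff k) * q k)).eval (w l) = ν l * ((q k).eval (w l) * R.eval (w l)) - R.coeff k * (ν l * ((q k).eval (w l)) ^ 2) := fun l => by
      rw [eval_mul, eval_sub, eval_mul, eval_C]; ring
    rw [Finset.sum_congr rfl fun l _ => hl l, Finset.sum_sub_distrib, ← Finset.mul_sum, sub_eq_zero] at h
    exact h

/-- **`σ_{k,k} = h_k`** (`X^k − q_k` has degree `< k`). [Gautschi 2004 (2.1.103); this file, §1093] -/
theorem mixedMoment_diag {N : ℕ} {ν w : Fin N → ℝ} {q : ℕ → ℝ[X]} {k : ℕ} (hmonic : (q k).Monic) (hdeg : (q k).natDegree = k)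
    (horth : ∀ G : ℝ[X], G.natDegree < k → ∑ l, ν l * (q k * G).eval (w l) = 0) :
    ∑ l, ν l * ((q k).eval (w l) * w l ^ k) = ∑ l, ν l * ((q k).eval (w l)) ^ 2 := by
  have h := sum_mul_eval_mul_eq_coeff_mul_norm hmonic hdeg horth (R := Polynomial.X ^ k) (by rw [natDegree_X_pow])
  simp only [eval_pow, eval_X, coeff_X_pow, if_true, one_mul] at h
  exact h

/-- **`σ_{k,k+1} = h_k·(a_0 + ⋯ + a_k)`** (`coeff_k(X^{k+1} − q_{k+1}) = Σ_{i≤k} a_i`, N298, and `q_k ⟂ q_{k+1}`). [Gautschi 2004 §2.1.7; this file, §1093] -/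
theorem mixedMoment_superdiag {N : ℕ} {ν w : Fin N → ℝ} {q : ℕ → ℝ[X]} {a b : ℕ → ℝ} (hq0 : q 0 = 1) (hq1 : q 1 = Polynomial.X - C (a 0))
    (hrec : ∀ n, q (n + 2) = (Polynomial.X - C (a (n + 1))) * q (n + 1) - C (b (n + 1)) * q n) {k : ℕ}
    (horth : ∀ j, j ≤ k + 1 → ∀ G : ℝ[X], G.natDegree < j → ∑ l, ν l * (q j * G).eval (w l) = 0) :
    ∑ l, ν l * ((q k).eval (w l) * w l ^ (k + 1)) = (∑ i ∈ Finset.range (k + 1), a i) * ∑ l, ν l * ((q k).eval (w l)) ^ 2 := by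
  have hmd := recurrence_monic_natDegree hq0 hq1 hrec
  -- split `X^{k+1} = q_{k+1} + (X^{k+1} − q_{k+1})`
  have hR : (Polynomial.X ^ (k + 1) - q (k + 1)).natDegree ≤ k := by
    have h := natDegree_sub_lt_of_monic_of_natDegree_eq (by omega : 1 ≤ k + 1) (monic_X_pow (k + 1)) (natDegree_X_pow (k + 1)) (hmd (k + 1)).1 (hmd (k + 1)).2
    omega
  have hcoeff : (Polynomial.X ^ (k + 1) - q (k + 1)).coeff k = ∑ i ∈ Finset.range (k + 1), a i := by
    rw [coeff_sub, coeff_X_pow, if_neg (by omega), coeff_recurrence_sub_one hq0 hq1 hrec k]; ring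
  have horthk1 : ∑ l, ν l * ((q k).eval (w l) * (q (k + 1)).eval (w l)) = 0 := by
    have h := horth (k + 1) le_rfl (q k) (by rw [(hmd k).2]; omega)
    rw [← h]; exact Finset.sum_congr rfl fun l _ => by rw [eval_mul]; ring
  have hsplit : ∀ l, ν l * ((q k).eval (w l) * w l ^ (k + 1)) = ν l * ((q k).eval (w l) * (q (k + 1)).eval (w l)) + ν l * ((q k).eval (w l) * (Polynomial.X ^ (k + 1) - q (k + 1)).eval (w l)) :=
    fun l => by rw [eval_sub, eval_pow, eval_X]; ring
  rw [Finset.sum_congr rfl fun l _ => hsplit l, Finset.sum_add_distrib, horthk1, zero_add,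
    sum_mul_eval_mul_eq_coeff_mul_norm (hmd k).1 (hmd k).2 (horth k (by omega)) hR, hcoeff]

/-- **CHEBYSHEV'S ALGORITHM: `a_0 = σ_{0,1}∕σ_{0,0} = (Σ ν w)∕(Σ ν)`, `a_{k+1} = σ_{k+1,k+2}∕σ_{k+1,k+1} − σ_{k,k+1}∕σ_{k,k}`, `b_{k+1} = σ_{k+1,k+1}∕σ_{k,k}`** (positive weights, distinct
nodes, `k + 1 < N`). [Chebyshev 1859; Gautschi 2004 Alg. 2.3; Wheeler 1974; this file, §1093] -/
theorem recurrence_coeffs_of_mixedMoments {N : ℕ} {ν w : Fin N → ℝ} (hν : ∀ l, 0 < ν l) (hw : Function.Injective w) {q : ℕ → ℝ[X]} {a b : ℕ → ℝ} (hq0 : q 0 = 1)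
    (hq1 : q 1 = Polynomial.X - C (a 0)) (hrec : ∀ n, q (n + 2) = (Polynomial.X - C (a (n + 1))) * q (n + 1) - C (b (n + 1)) * q n) {k : ℕ} (hkN : k + 1 < N)
    (horth : ∀ j, j ≤ k + 2 → ∀ G : ℝ[X], G.natDegree < j → ∑ l, ν l * (q j * G).eval (w l) = 0) :
    a 0 = (∑ l, ν l * w l) / ∑ l, ν l ∧
      a (k + 1) = (∑ l, ν l * ((q (k + 1)).eval (w l) * w l ^ (k + 1 + 1))) / (∑ l, ν l * ((q (k + 1)).eval (w l) * w l ^ (k + 1))) -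
        (∑ l, ν l * ((q k).eval (w l) * w l ^ (k + 1))) / ∑ l, ν l * ((q k).eval (w l) * w l ^ k) ∧
      b (k + 1) = (∑ l, ν l * ((q (k + 1)).eval (w l) * w l ^ (k + 1))) / ∑ l, ν l * ((q k).eval (w l) * w l ^ k) := by
  have hmd := recurrence_monic_natDegree hq0 hq1 hrec
  have hpos : ∀ j, j ≤ k + 1 → 0 < ∑ l, ν l * ((q j).eval (w l)) ^ 2 := fun j hj =>
    sum_mul_eval_sq_pos_of_natDegree_lt hν hw (hmd j).1.ne_zero (by rw [(hmd j).2]; omega)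
  have hd : ∀ j, j ≤ k + 1 → ∑ l, ν l * ((q j).eval (w l) * w l ^ j) = ∑ l, ν l * ((q j).eval (w l)) ^ 2 := fun j hj =>
    mixedMoment_diag (hmd j).1 (hmd j).2 (horth j (by omega))
  have hs : ∀ j, j ≤ k + 1 → ∑ l, ν l * ((q j).eval (w l) * w l ^ (j + 1)) = (∑ i ∈ Finset.range (j + 1), a i) * ∑ l, ν l * ((q j).eval (w l)) ^ 2 := fun j hj =>
    mixedMoment_superdiag hq0 hq1 hrec (fun i hi => horth i (by omega))
  refine ⟨?_, ?_, ?_⟩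
  · have h := hs 0 (by omega)
    simp only [hq0, eval_one, one_mul, Nat.zero_add, pow_one, Finset.sum_range_one, one_pow, mul_one] at h
    have hν0 : 0 < ∑ l, ν l := Finset.sum_pos (fun l _ => hν l) (Finset.univ_nonempty_iff.2 ⟨⟨0, by omega⟩⟩)
    rw [eq_div_iff hν0.ne', h]
  · rw [hd (k + 1) le_rfl, hd k (by omega), hs (k + 1) le_rfl, hs k (by omega), mul_div_assoc, mul_div_assoc,
      div_self (hpos (k + 1) le_rfl).ne', div_self (hpos k (by omega)).ne', mul_one, mul_one, Finset.sum_range_succ _ (k + 1)]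
    ring
  · rw [hd (k + 1) le_rfl, hd k (by omega)]
    exact b_eq_norm_div_norm hν hw hq0 hq1 hrec (by omega) horth

end Summit.Ventures.HSemireg.Wedge.HankelOuter
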